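import Mathlib
import Summits.Ventures.PercRepro2.CoinChainXATopGateAlg

/-!
# The TOP gate of the (j, j′) pair — the interpolation in the ideal mass, and the zero-ideal-mass
corner when one gate-killed shift is nonnegative (blind cell PercRepro2, night-2 g30; §72.10)

`cg_top_interp`: the top-gate functional is affine in the ideal mass `a` at fixed `a + δ` (the
identity interpolating between `a = 0` and `a = a + δ − XJ`).  `cg_top_a0_of_P0x`: at `a = 0`, when
the gate-killed `x`-shift `P̃⁰x = L·(XM − ω) − (t − ω)·Px` is nonnegative, a 28-term integer certificate
(kit j322332; the `y`-mirror is the same lemma with the markers swapped).  `cg_top_of_a0`: the top-gate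
functional is nonnegative for every ideal mass once its zero-ideal-mass value is — the reduction of
the three-coin top corner to its `a = 0` case (§72.10c).
-/

namespace Summit.Ventures.PercRepro2.Coin

section TopGateInterp

variable {R : Type*} [Field R] [LinearOrder R] [IsStrictOrderedRing R]

omit [LinearOrder R] [IsStrictOrderedRing R] in
/-- The top-gate functional is affine in the ideal mass at fixed `a + δ`. -/
theorem cg_top_interp (a δ u t XJ XU XM YJ YU YM w : R) :
    (a + δ - XJ) * ((a) * (a + δ + u + t) * (XJ + XU + XM) * (YJ + YU + YM)
        - (XJ * (a + δ + u + t) - (δ) * (XJ + XU + XM)) * (YM * (a + δ + u + t) - t * (YJ + YU + YM))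
        - (YJ * (a + δ + u + t) - (δ) * (YJ + YU + YM)) * (XM * (a + δ + u + t) - t * (XJ + XU + XM))
        + w * ((a + δ + u + t) * ((a + δ + u + t) - (XJ + XU + XM)) * ((a + δ + u + t) - (YJ + YU + YM))
            + (XJ * (a + δ + u + t) - (δ) * (XJ + XU + XM)) * ((a + δ + u + t) - (YJ + YU + YM))
            + (YJ * (a + δ + u + t) - (δ) * (YJ + YU + YM)) * ((a + δ + u + t) - (XJ + XU + XM))))
      = (δ - XJ) * ((0) * (0 + a + δ + u + t) * (XJ + XU + XM) * (YJ + YU + YM)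
        - (XJ * (0 + a + δ + u + t) - (a + δ) * (XJ + XU + XM)) * (YM * (0 + a + δ + u + t) - t * (YJ + YU + YM))
        - (YJ * (0 + a + δ + u + t) - (a + δ) * (YJ + YU + YM)) * (XM * (0 + a + δ + u + t) - t * (XJ + XU + XM))
        + w * ((0 + a + δ + u + t) * ((0 + a + δ + u + t) - (XJ + XU + XM)) * ((0 + a + δ + u + t) - (YJ + YU + YM))
            + (XJ * (0 + a + δ + u + t) - (a + δ) * (XJ + XU + XM)) * ((0 + a + δ + u + t) - (YJ + YU + YM))
            + (YJ * (0 + a + δ + u + t) - (a + δ) * (YJ + YU + YM)) * ((0 + a + δ + u + t) - (XJ + XU + XM)))) + a * ((a + δ - XJ) * (a + δ - XJ + XJ + u + t) * (XJ + XU + XM) * (YJ + YU + YM)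
        - (XJ * (a + δ - XJ + XJ + u + t) - (XJ) * (XJ + XU + XM)) * (YM * (a + δ - XJ + XJ + u + t) - t * (YJ + YU + YM))
        - (YJ * (a + δ - XJ + XJ + u + t) - (XJ) * (YJ + YU + YM)) * (XM * (a + δ - XJ + XJ + u + t) - t * (XJ + XU + XM))
        + w * ((a + δ - XJ + XJ + u + t) * ((a + δ - XJ + XJ + u + t) - (XJ + XU + XM)) * ((a + δ - XJ + XJ + u + t) - (YJ + YU + YM))
            + (XJ * (a + δ - XJ + XJ + u + t) - (XJ) * (XJ + XU + XM)) * ((a + δ - XJ + XJ + u + t) - (YJ + YU + YM))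
            + (YJ * (a + δ - XJ + XJ + u + t) - (XJ) * (YJ + YU + YM)) * ((a + δ - XJ + XJ + u + t) - (XJ + XU + XM)))) := by
  ring

/-- **The zero-ideal-mass corner of the top gate when the gate-killed `x`-shift is nonnegative**:
a 28-term integer certificate. -/
theorem cg_top_a0_of_P0x (J u t XJ XU XM YJ YU YM w : R)
    (hJ : 0 ≤ J) (hu : 0 ≤ u) (ht : 0 ≤ t) (hXJ : 0 ≤ XJ) (hXU : 0 ≤ XU)
    (hYJ : 0 ≤ YJ) (hYU : 0 ≤ YU) (hw : 0 ≤ w)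
    (hJUx : 0 ≤ XU * J - XJ * u) (hJMx : 0 ≤ XM * J - XJ * t)
    (hJUy : 0 ≤ YU * J - YJ * u) (hJMy : 0 ≤ YM * J - YJ * t)
    (hMcMy : 0 ≤ YM * (J + u) - (YJ + YU) * t)
    (hIMy : 0 ≤ (J - YJ) * w - YJ * (XM - w)) (hIMdy : 0 ≤ (u - YU) * w - YU * (XM - w))
    (hP0x : 0 ≤ (J + u + t) * (XM - w) - (t - w) * (XJ + XU + XM))
    (hXJJ : 0 ≤ J - XJ) (hXUu : 0 ≤ u - XU) (hXMt : 0 ≤ t - XM) (hYJJ : 0 ≤ J - YJ)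
    (hYUu : 0 ≤ u - YU) (hYMt : 0 ≤ t - YM) (hwXM : 0 ≤ XM - w) :
    0 ≤ (0) * (0 + J + u + t) * (XJ + XU + XM) * (YJ + YU + YM)
        - (XJ * (0 + J + u + t) - (J) * (XJ + XU + XM)) * (YM * (0 + J + u + t) - t * (YJ + YU + YM))
        - (YJ * (0 + J + u + t) - (J) * (YJ + YU + YM)) * (XM * (0 + J + u + t) - t * (XJ + XU + XM))
        + w * ((0 + J + u + t) * ((0 + J + u + t) - (XJ + XU + XM)) * ((0 + J + u + t) - (YJ + YU + YM))
            + (XJ * (0 + J + u + t) - (J) * (XJ + XU + XM)) * ((0 + J + u + t) - (YJ + YU + YM))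
            + (YJ * (0 + J + u + t) - (J) * (YJ + YU + YM)) * ((0 + J + u + t) - (XJ + XU + XM))) := by
  have H0 := (mul_nonneg hJUx hMcMy)
  have H1 := (mul_nonneg hJMx hMcMy)
  have H2 := (mul_nonneg hJMy hP0x)
  have H3 := (mul_nonneg (mul_nonneg hJUy hXJJ) hwXM)
  have H4 := (mul_nonneg (mul_nonneg hIMdy hXJJ) hJ)
  have H5 := (mul_nonneg (mul_nonneg hIMy hXUu) hu)
  have H6 := (mul_nonneg (mul_nonneg hP0x hJ) hYU)
  have H7 := (mul_nonneg (mul_nonneg (mul_nonneg hXJJ hYJJ) hJ) hw)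
  have H8 := (mul_nonneg (mul_nonneg (mul_nonneg hXJJ hYMt) hJ) hw)
  have H9 := (mul_nonneg (mul_nonneg (mul_nonneg hXUu hYJJ) hJ) hw)
  have H10 := (mul_nonneg (mul_nonneg (mul_nonneg hXUu hYJJ) ht) hw)
  have H11 := (mul_nonneg (mul_nonneg (mul_nonneg hXUu hYUu) hJ) hw)
  have H12 := (mul_nonneg (mul_nonneg (mul_nonneg hXUu hYUu) hu) hw)
  have H13 := (mul_nonneg (mul_nonneg (mul_nonneg hXUu hYUu) ht) hw)
  have H14 := (mul_nonneg (mul_nonneg (mul_nonneg hXUu hYMt) hJ) hw)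
  have H15 := (mul_nonneg (mul_nonneg (mul_nonneg hXUu hYMt) hu) hw)
  have H16 := (mul_nonneg (mul_nonneg (mul_nonneg hXUu hYMt) ht) hw)
  have H17 := (mul_nonneg (mul_nonneg (mul_nonneg hXMt hYJJ) hJ) hw)
  have H18 := (mul_nonneg (mul_nonneg (mul_nonneg hXMt hYJJ) ht) hw)
  have H19 := (mul_nonneg (mul_nonneg (mul_nonneg hXMt hYUu) hJ) hw)
  have H20 := (mul_nonneg (mul_nonneg (mul_nonneg hXMt hYUu) hu) hw)
  have H21 := (mul_nonneg (mul_nonneg (mul_nonneg hXMt hYUu) ht) hw)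
  have H22 := (mul_nonneg (mul_nonneg (mul_nonneg hXMt hYMt) hJ) hw)
  have H23 := (mul_nonneg (mul_nonneg (mul_nonneg hXMt hYMt) hu) hw)
  have H24 := (mul_nonneg (mul_nonneg (mul_nonneg hXMt hYMt) ht) hw)
  have H25 := (mul_nonneg (mul_nonneg (mul_nonneg hXMt hJ) hu) hw)
  have H26 := (mul_nonneg (mul_nonneg (mul_nonneg hXMt hu) hXJ) hYJ)
  have H27 := (mul_nonneg (mul_nonneg (mul_nonneg hXMt hu) hXU) hYJ)
  linear_combination H0 + H1 + H2 + H3 + H4 + H5 + H6 + H7 + H8 + 2 * H9 + H10 + 2 * H11 + H12 + H13 + 2 * H14 + H15 + H16 + 2 * H17 + H18 + 2 * H19 + H20 + H21 + 2 * H22 + H23 + H24 + H25 + H26 + H27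

/-- **THE TOP GATE REDUCES TO ITS ZERO-IDEAL-MASS CASE**: if the top-gate functional at `a = 0`
(with the killed mass `a + δ`) is nonnegative, so is the functional at `a`. -/
theorem cg_top_of_a0 (a δ u t XJ XU XM YJ YU YM w : R)
    (ha : 0 ≤ a) (hu : 0 ≤ u) (ht : 0 ≤ t) (hXJ : 0 ≤ XJ) (hXU : 0 ≤ XU) (hXM : 0 ≤ XM)
    (hYJ : 0 ≤ YJ) (hYU : 0 ≤ YU) (hYM : 0 ≤ YM) (hw : 0 ≤ w)
    (hJUx : 0 ≤ XU * (a + δ) - XJ * u) (hJMx : 0 ≤ XM * (a + δ) - XJ * t)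
    (hMcMx : 0 ≤ XM * (a + δ + u) - (XJ + XU) * t) (hJUy : 0 ≤ YU * (a + δ) - YJ * u)
    (hIMx : 0 ≤ (a + δ - XJ) * w - XJ * (YM - w)) (hIMy : 0 ≤ (a + δ - YJ) * w - YJ * (XM - w))
    (hXJδ : 0 ≤ δ - XJ) (hXUu : 0 ≤ u - XU) (hXMt : 0 ≤ t - XM) (hYJδ : 0 ≤ δ - YJ)
    (hYUu : 0 ≤ u - YU) (hYMt : 0 ≤ t - YM) (hwXM : 0 ≤ XM - w) (hwYM : 0 ≤ YM - w)
    (H0 : 0 ≤ (0) * (0 + a + δ + u + t) * (XJ + XU + XM) * (YJ + YU + YM)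
        - (XJ * (0 + a + δ + u + t) - (a + δ) * (XJ + XU + XM)) * (YM * (0 + a + δ + u + t) - t * (YJ + YU + YM))
        - (YJ * (0 + a + δ + u + t) - (a + δ) * (YJ + YU + YM)) * (XM * (0 + a + δ + u + t) - t * (XJ + XU + XM))
        + w * ((0 + a + δ + u + t) * ((0 + a + δ + u + t) - (XJ + XU + XM)) * ((0 + a + δ + u + t) - (YJ + YU + YM))
            + (XJ * (0 + a + δ + u + t) - (a + δ) * (XJ + XU + XM)) * ((0 + a + δ + u + t) - (YJ + YU + YM))
            + (YJ * (0 + a + δ + u + t) - (a + δ) * (YJ + YU + YM)) * ((0 + a + δ + u + t) - (XJ + XU + XM)))) :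
    0 ≤ (a) * (a + δ + u + t) * (XJ + XU + XM) * (YJ + YU + YM)
        - (XJ * (a + δ + u + t) - (δ) * (XJ + XU + XM)) * (YM * (a + δ + u + t) - t * (YJ + YU + YM))
        - (YJ * (a + δ + u + t) - (δ) * (YJ + YU + YM)) * (XM * (a + δ + u + t) - t * (XJ + XU + XM))
        + w * ((a + δ + u + t) * ((a + δ + u + t) - (XJ + XU + XM)) * ((a + δ + u + t) - (YJ + YU + YM))
            + (XJ * (a + δ + u + t) - (δ) * (XJ + XU + XM)) * ((a + δ + u + t) - (YJ + YU + YM))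
            + (YJ * (a + δ + u + t) - (δ) * (YJ + YU + YM)) * ((a + δ + u + t) - (XJ + XU + XM))) := by
  have hJ : 0 ≤ a + δ := by linarith
  have hT1 := cg_top_core (a + δ) u t XJ XU XM YJ YU YM w hJ hu ht hXJ hXU hXM hYJ hYU hYM hw
    hJUx hJMx hMcMx hJUy hIMx hIMy (by linarith) hXUu hXMt (by linarith) hYUu hYMt hwXM hwYM
  have hmax : 0 ≤ a + δ - XJ := by linarith
  have key : 0 ≤ (a + δ - XJ) * ((a) * (a + δ + u + t) * (XJ + XU + XM) * (YJ + YU + YM)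
        - (XJ * (a + δ + u + t) - (δ) * (XJ + XU + XM)) * (YM * (a + δ + u + t) - t * (YJ + YU + YM))
        - (YJ * (a + δ + u + t) - (δ) * (YJ + YU + YM)) * (XM * (a + δ + u + t) - t * (XJ + XU + XM))
        + w * ((a + δ + u + t) * ((a + δ + u + t) - (XJ + XU + XM)) * ((a + δ + u + t) - (YJ + YU + YM))
            + (XJ * (a + δ + u + t) - (δ) * (XJ + XU + XM)) * ((a + δ + u + t) - (YJ + YU + YM))
            + (YJ * (a + δ + u + t) - (δ) * (YJ + YU + YM)) * ((a + δ + u + t) - (XJ + XU + XM)))) := by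
    have e := cg_top_interp a δ u t XJ XU XM YJ YU YM w
    have h1 := mul_nonneg hXJδ H0
    have h2 := mul_nonneg ha hT1
    linear_combination h1 + h2 + e
  rcases hmax.lt_or_eq with hpos | hzero
  · exact (mul_nonneg_iff_of_pos_left hpos).1 key
  · have ha0 : a = 0 := by linarith
    subst ha0
    linear_combination H0

end TopGateInterp

end Summit.Ventures.PercRepro2.Coin
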